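import Summits.BirchSwinnertonDyer.Rank1Residual.X1.RankZero
import Summits.BirchSwinnertonDyer.BirchSwinnertonDyer.Theorems.Rank1ResidualX1RankOneOddPrime
import Literature.NumberTheory.EllipticCurves.Wuthrich2014.RankOneEngineOddPrimeProofs
import HarnessLib

/-!
# Residual class X1 ∩ {r = 1} (ANOMALOUS good Eisenstein prime, analytic rank ONE): the sub-cell STATEMENT

HONEST FRAMING (cell `b2b-bsdres`, run/shared/lean/b2b/bsd-rank1-residual/, verbatim in every
file): the goal of the cell is to DELETE the COMBINATION-SHAPED residual classes of the
Birch–Swinnerton-Dyer formula for ALL analytic-rank `≤ 1` elliptic curves over `ℚ` — "full BSD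
formula for every rank `≤ 1` curve in class `C`" assembled STRICTLY from published theorems — so
that the rank-`≤ 1` remainder becomes exactly the CONSTRUCTION-SHAPED classes, which are TYPED
(missing-input `Prop`s), NOT attempted. This is not "finishing BSD". CLASS-OWNERS.md (2026-08-20):
row "X1 (r = 1)" — research route; NO CLAIM BEYOND STATED CLASSES; no label change. The announced
preprint Keller–Yin arXiv:2402.12781v2 enters ONLY as an explicitly labelled OPEN hypothesis.

Unit `b2b-bsdres-x1a` (X1 prover A, gen 9). This is the STATEMENT FILE of the rank-ONE leaf of X1,
the companion of `X1/RankZero.lean` (sub-cell `eisenstein-p1`, rank `0`); its sequel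
`X1/RankOneRoutes.lean` keys the Keller–Yin route and the covered neighbours. It asserts NOTHING:
three definitions and bookkeeping theorems keyed BY NAME to decls already landed by the x1a / x1b
seats. PARTITION.md §3 row 18 ∩ {r = 1}: `p` odd, good, `E[p]` reducible, `a_p ≡ 1 (mod p)`
(anomalous), `ord_{s=1} L(E,s) = 1`. At `r = 1` the class clause `¬(r = 0 ∧ gvpar)` of `ClassX1` is
VACUOUS, so the leaf contains BOTH Greenberg–Vatsal parity types: A1 = type A (`¬ GVPar`; x1a's
"X1a"; census 717 of the 754 rank-one X1 pairs with `N < 2·10⁴`, job j041378) and B1 = type B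
(`GVPar`; 37 pairs) — `leaf_iff`, `leaf_cases`.

* `Leaf W p := ClassX1 W p ∧ W.analyticRank = 1`; `Statement := ∀ W p, Leaf W p → BSDp W p` (Miller's
  `BSD(E,p)`); `SchneiderOnLeaf` := Schneider's non-degeneracy of THE canonical cyclotomic `p`-adic
  height at every leaf pair (Schneider 1982/85; Mazur–Stein–Tate 2006 Conj. 1.1 — OPEN class-wide; per
  pair it IS the lane's finite certificate `[T¹]L_p(E,T) ≠ 0`, `Leaf.coeff_one_ne_zero_iff_schneider`).
* §1 `bsdpOnClassX1_iff_statements`: the typed class target `BSDpOnClassX1` (x1a `Rank1ResidualX1Defs`)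
  is EXACTLY `RankZero.Statement ∧ RankOne.Statement`.
* §2 ROUTE B (cyclotomic; x1b gens 3–4; PUBLISHED theorems + the certificate): on type B,
  `Leaf.bsdp_of_gvPar_of_schneider` (Greenberg–Vatsal 2000 Thm. 1.3 gives Mazur's main conjecture;
  Perrin-Riou–Schneider + Perrin-Riou 1987 + Mazur–Tate `σ` + GZK convert it, modulo Schneider); on the
  whole leaf `Leaf.mazurMainConjecture_iff_bsdp_of_schneider` (+ Wuthrich 2014 Thm. 16) and
  `statement_iff_forall_mazurMainConjecture_of_schneiderOnLeaf`: granted `SchneiderOnLeaf` and the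
  published facts, `Statement` ⟺ Mazur's main conjecture at every leaf pair, whose type-B instances
  are Greenberg–Vatsal's THEOREM (`Leaf.mazurMainConjecture_of_gvPar`) — so the residue of route B is
  {`MazurMainConjecture` at A1 pairs (unstated in print; x1a link L10)} ∪ {`SchneiderOnLeaf`}.
* §3 per pair: `Leaf.coeff_one_ne_zero_iff_schneider` (the certificate converter) and
  `Leaf.mazurMainConjecture_and_bsdp_of_shaAn_unit_of_schneider` (`p ∤ #Ш_an` + certificate ⇒ BOTH
  `BSD(E,p)` and Mazur's main conjecture — every one of the 754 census pairs has `p ∤ #Ш_an` and a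
  height-certificate value from two independent engines, x1a X1-CHAIN §12, x1b gen 5; uncertified by
  the lane, no verdict).

WHERE `r = 1` NEEDS MORE THAN `r = 0` (kickoff question, precise form). Route B: at `r = 0` Mazur's
main conjecture ⟺ `BSD(E,p)` with NO certificate (Greenberg Thm. 4.1; `RankZero.Leaf.mazurMainConjecture_iff_bsdp`);
at `r = 1` the same iff needs Schneider's non-degeneracy (the `p`-adic Gross–Zagier side: Perrin-Riou
1987 carries no anomaly hypothesis, but the leading-term comparison needs `⟨P,P⟩_p ≠ 0`), and type B —
absent at `r = 0` by the class clause — appears, closed by Greenberg–Vatsal modulo that certificate.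
Route A (`X1/RankOneRoutes.lean`): `r = 1` needs Keller–Yin's anticyclotomic IMC (3.0.11) and
torsion-tolerant control (7.0.6); NOT a Heegner-index input (the index `[E(K):ℤP_K]` cancels between
Gross–Zagier and the IMC side, [CGLS] (5.5)–(5.7)); for type B additionally the rank-`0` LEAF
statement at the partner.

References: RESIDUAL-CASES.md §a.2 X1; PARTITION.md §3 row 18; [KellerYin2024] Thm. 4.2.1 (PRE);
[GreenbergVatsal2000] Thm. (1.3); [Wuthrich2014] Thm. 16; [PerrinRiou1987] §1.4;
[BalakrishnanMullerStein2015] Thm. 1.7; [Balakrishnan2016] §2; [Schneider1985]; [MazurSteinTate2006]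
Conj. 1.1; [SteinWuthrich2013] §9; [Miller2011LMS] Def. 1.1.
-/

noncomputable section

open scoped Classical MatrixGroups ModularForm

open CongruenceSubgroup WeierstrassCurve Literature.NumberTheory.EllipticCurves
  Literature.NumberTheory.EllipticCurves.ModularForms
  Literature.NumberTheory.EllipticCurves.Wuthrich2014
  Literature.NumberTheory.EllipticCurves.Rank1Residual
  Summit.BirchSwinnertonDyer.BirchSwinnertonDyer.Theorems
  Summit.BirchSwinnertonDyer.BirchSwinnertonDyer.Theorems.Rank1ResidualX1Defs
  Summit.BirchSwinnertonDyer.BirchSwinnertonDyer.Theorems.Rank1ResidualX1Converse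

set_option autoImplicit false

namespace Summit.BirchSwinnertonDyer.Rank1Residual.X1.RankOne

/-! ### The leaf predicate, the sub-cell statement, and the rank-one certificate -/

/-- **The rank-one leaf of X1** (PARTITION.md §3 row 18 ∩ {r = 1}): the pair `(E, p)` is in residual
class X1 (tree predicate `Rank1Residual.ClassX1`, RESIDUAL-CASES §a.2 v3 verbatim) AND
`ord_{s=1} L(E,s) = 1`. Literally the tree class conjoined with the rank — no re-typing. Both parity
types occur (`leaf_iff`: the class clause is vacuous at `r = 1`). [folklore] -/
def Leaf (W : WeierstrassCurve ℚ) [W.IsGloballyMinimal] (p : ℕ) [Fact p.Prime] : Prop :=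
  ClassX1 W p ∧ W.analyticRank = 1

/-- **The sub-cell TARGET (research route; NO CLAIM):** for every globally minimal elliptic `W/ℚ` and
prime `p` on the rank-one leaf, Miller's `BSD(E,p)`. Announced (Keller–Yin arXiv:2402.12781v2 Thm. 3 =
Thm. 4.2.1, PREPRINT); not a theorem of the published record. Consumed only as a hypothesis.
[cite: KellerYin2024, Thm. 4.2.1 (announced statement; shape only; nothing asserted)] -/
@[conjecture] def Statement : Prop :=
  ∀ (W : WeierstrassCurve ℚ) [W.IsElliptic] [W.IsGloballyMinimal] (p : ℕ) [Fact p.Prime],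
    Leaf W p → BSDp W p

/-- **What `r = 1` needs beyond `r = 0` on the cyclotomic route, TYPED (nothing asserted): Schneider's
conjecture on the leaf.** At every leaf pair, THE canonical cyclotomic `p`-adic height (sigma
normalisation; unique at odd good ordinary `p`, `existsUnique_isCanonical_of_odd`) is non-degenerate
(`SchneiderConjecture`). Schneider 1982/1985; Mazur–Stein–Tate, Doc. Math. Extra Vol. (2006) p. 4,
Conj. 1.1 ("The cyclotomic height pairing is nondegenerate; equivalently, the `p`-adic regulator is
nonzero") — OPEN class-wide (no published case covers a non-CM rank-one curve); per pair it is
EQUIVALENT to the finite `p`-adic computation `[T¹]L_p(E,T) ≠ 0` (`Leaf.coeff_one_ne_zero_iff_schneider`),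
whose value the cell holds, uncertified, at all 754 rank-one X1 census pairs (`N < 2·10⁴`).
[cite: MazurSteinTate2006, Conj. 1.1 (p. 4) (the conjecture; nothing asserted)] [cite: Schneider1985, §1] -/
@[conjecture] def SchneiderOnLeaf : Prop :=
  ∀ (W : WeierstrassCurve ℚ) [W.IsElliptic] [W.IsGloballyMinimal] (p : ℕ) [Fact p.Prime],
    Leaf W p → ∀ Dh : PAdicHeightData W p, Dh.IsCanonical → SchneiderConjecture Dh

variable {W : WeierstrassCurve ℚ} [W.IsGloballyMinimal] {p : ℕ} [Fact p.Prime]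

/-- Unfolding of the leaf: `p > 2`, `E[p]` reducible, good reduction, anomalous (`a_p ≡ 1 (mod p)`),
analytic rank `1` — and NO parity clause: at `r = 1` the class clause `¬(r = 0 ∧ gvpar)` holds
automatically, so both Greenberg–Vatsal types are on the leaf. [folklore] -/
theorem leaf_iff : Leaf W p ↔ 2 < p ∧ Red W p ∧ Good W p ∧ Anom W p ∧ W.analyticRank = 1 := by
  constructor
  · rintro ⟨⟨hp, hred, hgood, hanom, -⟩, hr1⟩
    exact ⟨hp, hred, hgood, hanom, hr1⟩
  · rintro ⟨hp, hred, hgood, hanom, hr1⟩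
    exact ⟨⟨hp, hred, hgood, hanom, fun h ↦ by have := h.1; omega⟩, hr1⟩

/-- A leaf pair has analytic rank `1`. [folklore] -/
theorem Leaf.analyticRank_eq_one (h : Leaf W p) : W.analyticRank = 1 := h.2

/-- `2 < p` on the leaf. [folklore] -/
theorem Leaf.two_lt (h : Leaf W p) : 2 < p := h.1.1

/-- `p ≠ 2` on the leaf. [folklore] -/
theorem Leaf.two_ne (h : Leaf W p) : p ≠ 2 := by
  have := h.two_lt
  omega

/-- A leaf pair is good ORDINARY (anomalous `a_p ≡ 1 (mod p)` forces `p ∤ a_p`; tree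
`Rank1Residual.isClassX1_of_classX1`), in the `IsOrdinaryAt` packaging of the `p`-adic files; the
`GoodOrd` form is `RankZero.Leaf.goodOrd`'s proof verbatim (`goodOrd_of_anom`). [folklore] -/
theorem Leaf.isOrdinaryAt (h : Leaf W p) : IsOrdinaryAt W p :=
  have hX := isClassX1_of_classX1 h.1
  ⟨hX.hasGoodReductionAtPrime, hX.not_dvd_frobeniusTrace⟩

/-- Constructor: an X1 pair with analytic rank `1` is on the leaf (either parity type). [folklore] -/
theorem leaf_of_classX1 (hX1 : ClassX1 W p) (hr1 : W.analyticRank = 1) : Leaf W p := ⟨hX1, hr1⟩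

/-- **The leaf is A1 ⊔ B1:** every leaf pair is of type A (`¬ GVPar`, x1a's sub-class X1a; e.g. a
rank-one curve with a rational `p`-torsion point at a good `p > 2`) or of type B (`GVPar`, x1b's B1).
Census (`N < 2·10⁴`, job j041378): 717 + 37 pairs. [folklore] -/
theorem leaf_cases (h : Leaf W p) : (Leaf W p ∧ ¬ GVPar W p) ∨ (Leaf W p ∧ GVPar W p) :=
  (em (GVPar W p)).elim (fun hB ↦ Or.inr ⟨h, hB⟩) (fun hA ↦ Or.inl ⟨h, hA⟩)

/-- The two leaves of X1 are disjoint. [folklore] -/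
theorem Leaf.not_rankZeroLeaf (h : Leaf W p) : ¬ RankZero.Leaf W p := fun h0 ↦ by
  have h1 := h.2
  rw [h0.analyticRank_eq_zero] at h1
  exact zero_ne_one h1

/-- **X1 ∩ {r ≤ 1} is the union of the two leaves.** [folklore] -/
theorem rankZeroLeaf_or_leaf (hX1 : ClassX1 W p) (hr : W.analyticRank ≤ 1) :
    RankZero.Leaf W p ∨ Leaf W p := by
  rcases Nat.le_one_iff_eq_zero_or_eq_one.mp hr with h0 | h1
  · exact Or.inl ⟨hX1, h0⟩
  · exact Or.inr ⟨hX1, h1⟩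

/-! ### §1. The class target is exactly the two leaf statements -/

/-- `Statement` in the class form used by the x1a/x1b files: the rank-`1` half of
`Rank1ResidualX1Defs.BSDpOnClassX1`. Pure logic. [folklore] -/
theorem statement_iff_classForm : Statement ↔
    ∀ (W : WeierstrassCurve ℚ) [W.IsElliptic] [W.IsGloballyMinimal] (p : ℕ) [Fact p.Prime],
      ClassX1 W p → W.analyticRank = 1 → BSDp W p :=
  ⟨fun h W _ _ p _ hX1 hr1 ↦ h W p ⟨hX1, hr1⟩, fun h W _ _ p _ hL ↦ h W p hL.1 hL.2⟩

/-- **The typed class target X1 is EXACTLY the conjunction of the two leaf statements:**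
`BSDpOnClassX1 ↔ RankZero.Statement ∧ RankOne.Statement` (x1a's typed target, announced by
Keller–Yin, PRE; in particular it implies the rank-one statement). Pure logic over
`r_an ≤ 1 ⟺ r_an ∈ {0,1}`.
[cite: KellerYin2024, Thm. 4.2.1 (p. 22) (announced; nothing asserted)] -/
theorem bsdpOnClassX1_iff_statements : BSDpOnClassX1 ↔ RankZero.Statement ∧ Statement := by
  constructor
  · exact fun h ↦ ⟨RankZero.statement_of_bsdpOnClassX1 h, fun W _ _ p _ hL ↦ h W p hL.1 hL.2.le⟩
  · rintro ⟨h0, h1⟩ W _ _ p _ hX1 hr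
    rcases rankZeroLeaf_or_leaf hX1 hr with hL | hL
    · exact h0 W p hL
    · exact h1 W p hL

/-! ### §2. Route B (cyclotomic): PUBLISHED theorems plus the Schneider certificate -/

/-- **B1 from the published record, modulo the certificate** (x1b; no Keller–Yin, no partner main
conjecture): at a leaf pair of type B (`GVPar W p`), `BSD(E,p)` follows from Greenberg–Vatsal 2000
Thm. (1.3) (`hGV`: Mazur's main conjecture under the parity condition), Perrin-Riou–Schneider at odd
`p` (`hS`, BMS 2016 Thm. 1.7), Perrin-Riou 1987 (`hPR`), the Mazur–Tate sigma function (`hMT`),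
modularity (`hmod`), Gross–Zagier–Kolyvagin (`hGZK`) — all PUBLISHED — and Schneider's non-degeneracy
at the pair (`hSch`). Tree: `Rank1Residual.X1.bsdp_of_gvPar_of_analyticRank_eq_one`.
[cite: GreenbergVatsal2000, Thm. (1.3)] [cite: PerrinRiou1987, §1.4 Cor. 1.8]
[cite: BalakrishnanMullerStein2015, Thm. 1.7] [cite: Balakrishnan2016, §2] -/
theorem Leaf.bsdp_of_gvPar_of_schneider [W.IsElliptic]
    (hGV : GreenbergVatsal2000.thm13_charIdeal_eq_of_gvPar)
    (hS : Schneider1985_order_charGenerator_odd) (hPR : perrinRiou_rankOne_leadingTerms_odd)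
    (hMT : mazur_tate_sigma_exists_odd) (hmod : nonempty_modularParametrizationData)
    (hGZK : rank_eq_analyticRank_of_analyticRank_le_one) (h : Leaf W p) (hB : GVPar W p)
    (hSch : ∀ Dh : PAdicHeightData W p, Dh.IsCanonical → SchneiderConjecture Dh) : BSDp W p :=
  Literature.NumberTheory.EllipticCurves.Rank1Residual.X1.bsdp_of_gvPar_of_analyticRank_eq_one hGV hS
    hPR hMT hmod hGZK W p h.1 h.2 hB hSch

/-- **Greenberg–Vatsal's theorem IS Mazur's main conjecture at the type-B leaf pairs** (the named
fact's body; via `Rank1ResidualX1RankOne.mazurMainConjecture_of_gvPar`). So on the leaf the typed input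
`MazurMainConjecture W p` is open only on type A. [cite: GreenbergVatsal2000, Thm. (1.3)] -/
theorem Leaf.mazurMainConjecture_of_gvPar [W.IsElliptic]
    (hGV : GreenbergVatsal2000.thm13_charIdeal_eq_of_gvPar) (h : Leaf W p) (hB : GVPar W p) :
    MazurMainConjecture W p :=
  have hX := isClassX1_of_classX1 h.1
  Rank1ResidualX1RankOne.mazurMainConjecture_of_gvPar hGV W p h.two_ne hX.hasGoodReductionAtPrime
    hX.not_dvd_frobeniusTrace hB

/-- **On the whole leaf, modulo the certificate: Mazur's main conjecture ⟺ `BSD(E,p)`** (x1b gen 4,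
every prime of the class), granted the PUBLISHED named facts Wuthrich 2014 Thm. 16 (`hW16`),
Perrin-Riou–Schneider (`hS`), Perrin-Riou 1987 (`hPR`), Mazur–Tate sigma (`hMT`), modularity (`hmod`),
GZK (`hGZK`). The rank-`0` leaf has the same iff with NO certificate
(`RankZero.Leaf.mazurMainConjecture_iff_bsdp`): the certificate is exactly what `r = 1` adds.
[cite: Wuthrich2014, Thm. 16 (p. 393) and §6 (p. 400)] [cite: PerrinRiou1987, §1.4 Cor. 1.8]
[cite: BalakrishnanMullerStein2015, Thm. 1.7] [cite: Balakrishnan2016, §2] -/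
theorem Leaf.mazurMainConjecture_iff_bsdp_of_schneider [W.IsElliptic]
    (hW16 : Wuthrich2014.charIdeal_dvd_padicLFunction) (hS : Schneider1985_order_charGenerator_odd)
    (hPR : perrinRiou_rankOne_leadingTerms_odd) (hMT : mazur_tate_sigma_exists_odd)
    (hmod : nonempty_modularParametrizationData) (hGZK : rank_eq_analyticRank_of_analyticRank_le_one)
    (h : Leaf W p) (hSch : ∀ Dh : PAdicHeightData W p, Dh.IsCanonical → SchneiderConjecture Dh) :
    MazurMainConjecture W p ↔ BSDp W p :=
  Rank1ResidualX1RankOneOddPrime.mazurMainConjecture_iff_bsdp_of_analyticRank_eq_one hW16 hS hPR hMT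
    hmod hGZK W p h.1 h.2 hSch

/-- **The direction in which the typed input is consumed needs no Wuthrich input:** at a leaf pair,
`MazurMainConjecture W p` + the certificate ⇒ `BSD(E,p)` (Perrin-Riou–Schneider, Perrin-Riou 1987,
Mazur–Tate sigma, modularity, GZK). [cite: PerrinRiou1987, §1.4 Cor. 1.8]
[cite: BalakrishnanMullerStein2015, Thm. 1.7] [cite: Balakrishnan2016, §2] -/
theorem Leaf.bsdp_of_mazurMainConjecture_of_schneider [W.IsElliptic]
    (hS : Schneider1985_order_charGenerator_odd) (hPR : perrinRiou_rankOne_leadingTerms_odd)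
    (hMT : mazur_tate_sigma_exists_odd) (hmod : nonempty_modularParametrizationData)
    (hGZK : rank_eq_analyticRank_of_analyticRank_le_one) (h : Leaf W p)
    (hSch : ∀ Dh : PAdicHeightData W p, Dh.IsCanonical → SchneiderConjecture Dh)
    (hMC : MazurMainConjecture W p) : BSDp W p :=
  Rank1ResidualX1RankOneOddPrime.bsdp_of_classX1_of_analyticRank_eq_one_of_mazurMC hS hPR hMT hmod
    hGZK W p h.1 h.2 hSch hMC

/-- **Route B at class level: the rank-one statement from Mazur's main conjecture ON TYPE A plus
Schneider on the leaf** (type B being Greenberg–Vatsal's theorem), granted the PUBLISHED facts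
Greenberg–Vatsal (`hGV`), Perrin-Riou–Schneider (`hS`), Perrin-Riou 1987 (`hPR`), Mazur–Tate sigma
(`hMT`), modularity (`hmod`), GZK (`hGZK`). The hypothesis `hA1` is Mazur's main conjecture at the
RANK-ONE TYPE-A anomalous Eisenstein pairs only — unstated in print (x1a link L10; the rank-one slice
of `MazurMainConjectureOnX1TypeA`). [cite: GreenbergVatsal2000, Thm. (1.3)]
[cite: PerrinRiou1987, §1.4 Cor. 1.8] [cite: BalakrishnanMullerStein2015, Thm. 1.7] -/
theorem statement_of_mazurMainConjecture_typeA_of_schneiderOnLeaf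
    (hA1 : ∀ (W : WeierstrassCurve ℚ) [W.IsElliptic] [W.IsGloballyMinimal] (p : ℕ) [Fact p.Prime],
      Leaf W p → ¬ GVPar W p → MazurMainConjecture W p)
    (hSchL : SchneiderOnLeaf)
    (hGV : GreenbergVatsal2000.thm13_charIdeal_eq_of_gvPar)
    (hS : Schneider1985_order_charGenerator_odd) (hPR : perrinRiou_rankOne_leadingTerms_odd)
    (hMT : mazur_tate_sigma_exists_odd) (hmod : nonempty_modularParametrizationData)
    (hGZK : rank_eq_analyticRank_of_analyticRank_le_one) : Statement := by
  intro W _ _ p _ h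
  by_cases hB : GVPar W p
  · exact h.bsdp_of_gvPar_of_schneider hGV hS hPR hMT hmod hGZK hB (hSchL W p h)
  · exact h.bsdp_of_mazurMainConjecture_of_schneider hS hPR hMT hmod hGZK (hSchL W p h) (hA1 W p h hB)

/-- The same with x1a's typed residue `MazurMainConjectureOnX1TypeA` (both ranks) as the type-A input.
[cite: GreenbergVatsal2000, Thm. (1.3)] [cite: PerrinRiou1987, §1.4 Cor. 1.8] -/
theorem statement_of_mazurMainConjectureOnX1TypeA_of_schneiderOnLeaf
    (hA : MazurMainConjectureOnX1TypeA) (hSchL : SchneiderOnLeaf)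
    (hGV : GreenbergVatsal2000.thm13_charIdeal_eq_of_gvPar)
    (hS : Schneider1985_order_charGenerator_odd) (hPR : perrinRiou_rankOne_leadingTerms_odd)
    (hMT : mazur_tate_sigma_exists_odd) (hmod : nonempty_modularParametrizationData)
    (hGZK : rank_eq_analyticRank_of_analyticRank_le_one) : Statement :=
  statement_of_mazurMainConjecture_typeA_of_schneiderOnLeaf (fun W _ _ p _ h hA1 ↦ hA W p h.1 hA1)
    hSchL hGV hS hPR hMT hmod hGZK

/-- **The missing input of route B is EXACTLY Mazur's main conjecture on the leaf, modulo Schneider.**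
Granted `SchneiderOnLeaf` and the PUBLISHED named facts Wuthrich 2014 Thm. 16 (`hW16`),
Perrin-Riou–Schneider (`hS`), Perrin-Riou 1987 (`hPR`), Mazur–Tate sigma (`hMT`), modularity (`hmod`),
GZK (`hGZK`): `Statement` ⟺ `MazurMainConjecture W p` at EVERY leaf pair (x1b's kernel iff re-keyed
to the leaf; its type-B instances are theorems, `Leaf.mazurMainConjecture_of_gvPar`). Compare
`RankZero.statement_iff_forall_mazurMainConjecture` (no certificate).
[cite: Wuthrich2014, Thm. 16 (p. 393) and §6] [cite: PerrinRiou1987, §1.4 Cor. 1.8]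
[cite: BalakrishnanMullerStein2015, Thm. 1.7] -/
theorem statement_iff_forall_mazurMainConjecture_of_schneiderOnLeaf (hSchL : SchneiderOnLeaf)
    (hW16 : Wuthrich2014.charIdeal_dvd_padicLFunction) (hS : Schneider1985_order_charGenerator_odd)
    (hPR : perrinRiou_rankOne_leadingTerms_odd) (hMT : mazur_tate_sigma_exists_odd)
    (hmod : nonempty_modularParametrizationData) (hGZK : rank_eq_analyticRank_of_analyticRank_le_one) :
    Statement ↔
    ∀ (W : WeierstrassCurve ℚ) [W.IsElliptic] [W.IsGloballyMinimal] (p : ℕ) [Fact p.Prime],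
      Leaf W p → MazurMainConjecture W p := by
  constructor
  · intro hSt W _ _ p _ h
    exact (h.mazurMainConjecture_iff_bsdp_of_schneider hW16 hS hPR hMT hmod hGZK (hSchL W p h)).mpr
      (hSt W p h)
  · intro hMC W _ _ p _ h
    exact (h.mazurMainConjecture_iff_bsdp_of_schneider hW16 hS hPR hMT hmod hGZK (hSchL W p h)).mp
      (hMC W p h)

/-! ### §3. Per pair: the certificate, in the currency the lane computes -/

/-- **The certificate converter at a leaf pair:** for THE canonical height datum `Dh` and any newform
`f` of `E`, `[T¹]L_p(f,α,T) ≠ 0 ↔ SchneiderConjecture Dh` (Perrin-Riou 1987 at odd `p`, `hPR`; GZK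
`hGZK`; tree `Wuthrich2014.coeff_one_padicLFunction_ne_zero_iff_schneider_odd`). So `SchneiderOnLeaf`
at a pair is a finite `p`-adic `L`-series computation. [cite: PerrinRiou1987, §1.4 Cor. 1.8]
[cite: SteinWuthrich2013, §§3–4, §9] -/
theorem Leaf.coeff_one_ne_zero_iff_schneider [W.IsElliptic] (hPR : perrinRiou_rankOne_leadingTerms_odd)
    (hGZK : rank_eq_analyticRank_of_analyticRank_le_one) (h : Leaf W p)
    (Dh : PAdicHeightData W p) (hDh : Dh.IsCanonical) {N : ℕ} [NeZero N]
    (f : CuspForm (Gamma0 N) 2) (hf : IsNewformOf W f) :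
    PowerSeries.coeff 1 (padicLFunction f (unitRoot W p : ℚ_[p])) ≠ 0 ↔ SchneiderConjecture Dh :=
  coeff_one_padicLFunction_ne_zero_iff_schneider_odd hPR hGZK W p h.two_ne h.isOrdinaryAt h.2 Dh hDh f hf

/-- **Certificate ⇒ Schneider at the pair** (`[T¹]L_p ≠ 0` for SOME newform of `E`).
[cite: PerrinRiou1987, §1.4 Cor. 1.8] [cite: SteinWuthrich2013, §§3–4, §9] -/
theorem Leaf.schneider_of_coeff_one_ne_zero [W.IsElliptic] (hPR : perrinRiou_rankOne_leadingTerms_odd)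
    (hGZK : rank_eq_analyticRank_of_analyticRank_le_one) (h : Leaf W p) {N : ℕ} [NeZero N]
    (f : CuspForm (Gamma0 N) 2) (hf : IsNewformOf W f)
    (hcoeff : PowerSeries.coeff 1 (padicLFunction f (unitRoot W p : ℚ_[p])) ≠ 0) :
    ∀ Dh : PAdicHeightData W p, Dh.IsCanonical → SchneiderConjecture Dh :=
  Literature.NumberTheory.EllipticCurves.Rank1Residual.X1.schneider_of_coeff_one_ne_zero_odd hPR hGZK
    W p h.1 h.2 f hf hcoeff

/-- **Per pair: `p ∤ #Ш(E/ℚ)_an` + certificate ⇒ BOTH Mazur's main conjecture and `BSD(E,p)`** at a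
leaf pair of either type (Wuthrich Thm. 16, Perrin-Riou–Schneider, Perrin-Riou 1987, Mazur–Tate sigma,
modularity, GZK — all PUBLISHED). Census pointer (not a verdict): every one of the 754 rank-one X1
pairs with `N < 2·10⁴` has `p ∤ #Ш_an` and a height-certificate value from two independent engines
(x1a X1-CHAIN §12a/§12g/§12h; x1b gen 5), uncertified by the lane.
[cite: Wuthrich2014, Thm. 16 and §6] [cite: PerrinRiou1987, §1.4 Cor. 1.8]
[cite: Balakrishnan2016, §2] [cite: Miller2011LMS, Def. 1.1 (arXiv:1010.2431 p. 3)] -/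
theorem Leaf.mazurMainConjecture_and_bsdp_of_shaAn_unit_of_schneider [W.IsElliptic]
    (hW16 : Wuthrich2014.charIdeal_dvd_padicLFunction) (hS : Schneider1985_order_charGenerator_odd)
    (hPR : perrinRiou_rankOne_leadingTerms_odd) (hMT : mazur_tate_sigma_exists_odd)
    (hmod : nonempty_modularParametrizationData) (hGZK : rank_eq_analyticRank_of_analyticRank_le_one)
    (h : Leaf W p) (hSch : ∀ Dh : PAdicHeightData W p, Dh.IsCanonical → SchneiderConjecture Dh)
    (hunit : ∃ q : ℚ, shaAn W = (q : ℂ) ∧ padicValRat p q = 0) :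
    MazurMainConjecture W p ∧ BSDp W p :=
  Rank1ResidualX1RankOneOddPrime.mazurMainConjecture_and_bsdp_of_shaAn_unit_of_analyticRank_eq_one hW16
    hS hPR hMT hmod hGZK W p h.1 h.2 hSch hunit

end Summit.BirchSwinnertonDyer.Rank1Residual.X1.RankOne

end
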